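/-
Copyright (c) 2026 the pub-hodgecm-mathlib formalisation cell (harness21).  Prover seat hodgecm-mathlib-F0P3a-p04 (g31): E1 row 47d, FILE 5a «THE GLOBAL SCHNEIDER–STUHLER COMPLEX
`0 → C₁(X) → C₀(X) → V|_X → 0` AS A SHORT EXACT SEQUENCE OF SMOOTH `Γ`-REPRESENTATIONS BY BLOCK-PERMUTATION MODULES» (the tree side of the instantiation of ★ 47c FILE 4 ∕ 4χ-b;
dealt by the E1 keeper F0P3a-p03 (g30) 02:58:32Z), over ★ 41d FILES I–II (F0P3-p02) and ★ 41f-B1, 2026-09-03.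
-/
import Literature.NumberTheory.Automorphic.SchneiderStuhlerTreeComplexSmooth   -- ★ 41f-B1: `isSmooth_rep_zeroChains/oneChains/restricted`; brings ★ 41d FILE II (`rep_zeroChains_apply`, `rep_*_mem_*`, `boundaryMap_rep`, `augmentationMap_rep`) and FILE I (`shortExact_restrict`, `iSupIndep_zeroBlocks/oneBlocks`)
import HarnessLib

/-!
# The global Schneider–Stuhler complex as a short exact sequence of smooth `Γ`-representations by block-permutation modules

Topic `NumberTheory/Automorphic`; namespace `Representation`; THEOREMS ONLY (no definition, instance, notation or named fact); imports ★ 41f-B1 (hence ★ 41d I–II) + HarnessLib.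
Cell `pub/hodgecm-mathlib` (D-0151), crux H413 = `stmt-HodgeConjecture-24833`, lane `--supports`; E1 row 47d (β) «FILE 5»: the instantiation of ★ 47c FILE 4 ∕ 47c-4χ(b) (whose
setting is an abstract short exact sequence `0 → M₁ → M₀ → V → 0` of `G`-representations with `M₀` smooth, each `M_q` an internal direct sum of blocks permuted by `G`) at the
Schneider–Stuhler complex of ★ 41d on the WHOLE tree `X` (`S = univ`).  Count-neutral generic base layer; HC_CM is proved only modulo the 7 printed citations (2 remaining named
inputs: hLiu418 = `stmt-HodgeConjecture-24832`, h413 = `stmt-HodgeConjecture-24833`) until rung 0 closes.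

* §1 Generic: a `Γ`-stable submodule carries a `Γ`-representation (`exists_rep_of_forall_apply_mem`, Mathlib `Subrepresentation`); smoothness descends from `Γ` read as its own
  subgroup `⊤` (`isSmooth_of_isSmooth_comp_subtype_top`, so that ★ B1's `P`-statements serve for `P = Γ`); an independent family of submodules is an INTERNAL direct sum of its
  supremum (`isInternal_comap_subtype_of_iSupIndep`); finite-dimensionality of a block read inside the supremum.
* §2 Pointwise: `g · [x ↦ v] = [g·x ↦ ρ(g) v]` on `0`- and `1`-chains (`rep_zeroChains_single`, `rep_oneChains_single`); `ρ(g) V^{U_x} ⊆ V^{U_{g·x}}`, `ρ(g) V^{U_e} ⊆ V^{U_{g·e}}`.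
* §3 The three modules `C₁(X)`, `C₀(X)`, `V|_X` are `Γ`-representations (`exists_reps_univ`), SMOOTH (`isSmooth_rep_*_univ`), the boundary and augmentation maps are intertwining maps
  (`exists_intertwiningMap_boundary/augmentation`) forming a SHORT EXACT SEQUENCE (`shortExact_univ`, ★ FILE I `shortExact_restrict` at `S = univ`).
* §4 The vertex blocks `[x ↦ V^{U_x}]` and edge blocks `[e ↦ V^{U_e}]` are INTERNAL direct sums of `C₀(X)`, `C₁(X)` (`isInternal_zeroBlocks_univ`, `isInternal_oneBlocks_univ`), PERMUTED
  by `Γ` along the action on vertices ∕ edges (`rep_mem_zeroBlock`, `rep_mem_oneBlock`), finite-dimensional when the `V^{U_x}` are — the letters `h₁ hact hact1 hperm hfd` of ★ 47c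
  FILE 3 ∕ 4 ∕ 4χ-b.

## References
* [SchneiderStuhler1997] P. Schneider, U. Stuhler, *Representation theory and sheaves on the Bruhat–Tits building*, Publ. Math. IHÉS 85 (1997), Ch. II §3 (Thm. II.3.1), Ch. III §4.
* [MeyerSolleveld2010] R. Meyer, M. Solleveld, *Resolutions for representations of reductive p-adic groups via their buildings*, J. reine angew. Math. 647 (2010), §2 Thm. 2.4, §4.
* [Casselman1995] W. Casselman, *Introduction to the theory of admissible representations of `p`-adic reductive groups* (1995 notes), §6.3.
-/

set_option autoImplicit false

open scoped BigOperators Pointwise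
open SimpleGraph Finset
open Literature.NumberTheory.Automorphic Literature.Combinatorics.SimpleGraph Literature.Combinatorics.SimpleGraph.OrientedIncidence

namespace Representation

/-! ## §1 Generic -/

section Generic

variable {k Γ M : Type*} [Field k] [Group Γ] [AddCommGroup M] [Module k M]

/-- A `Γ`-STABLE submodule carries a `Γ`-representation agreeing with the ambient one (Mathlib `Subrepresentation.toRepresentation`; ★ 41d-II `exists_rep_submodule` is the version
for a subgroup `P ≤ Γ`). [cite: MeyerSolleveld2010, §4 Prop. 4.1] -/
theorem exists_rep_of_forall_apply_mem (τ : Representation k Γ M) (W : Submodule k M) (hW : ∀ (g : Γ) (w : M), w ∈ W → τ g w ∈ W) :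
    ∃ τW : Representation k Γ W, ∀ (g : Γ) (w : W), ((τW g w : W) : M) = τ g w :=
  ⟨(⟨W, fun g _ hw => hW g _ hw⟩ : Subrepresentation τ).toRepresentation, fun _ _ => rfl⟩

/-- SMOOTHNESS DESCENDS FROM `Γ` READ AS ITS SUBGROUP `⊤`: if `τ ∘ (⊤ ↪ Γ)` is smooth (for the subspace topology of `⊤`) then `τ` is smooth. [cite: Casselman1995, §2.1] -/
theorem isSmooth_of_isSmooth_comp_subtype_top [TopologicalSpace Γ] {τ : Representation k Γ M}
    (h : Representation.IsSmooth (τ.comp (⊤ : Subgroup Γ).subtype : Representation k (⊤ : Subgroup Γ) M)) : τ.IsSmooth := by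
  intro v
  have ho := h v
  have hset : ((Representation.stabilizerSubgroup (τ.comp (⊤ : Subgroup Γ).subtype : Representation k (⊤ : Subgroup Γ) M) v : Subgroup (⊤ : Subgroup Γ)) :
      Set (⊤ : Subgroup Γ)) =
      Subtype.val ⁻¹' (τ.stabilizerSubgroup v : Set Γ) := by
    ext g
    simp only [SetLike.mem_coe, mem_stabilizerSubgroup, Set.mem_preimage]
    rfl
  rw [IsSmoothVector, hset] at ho
  have hemb : Topology.IsOpenEmbedding (Subtype.val : (⊤ : Subgroup Γ) → Γ) := by
    refine IsOpen.isOpenEmbedding_subtypeVal ?_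
    rw [Subgroup.coe_top]
    exact isOpen_univ
  have himg := hemb.isOpenMap _ ho
  rw [Set.image_preimage_eq_inter_range, Subtype.range_coe_subtype] at himg
  show IsOpen ((τ.stabilizerSubgroup v : Set Γ))
  simpa only [Subgroup.mem_top, Set.setOf_true, Set.inter_univ] using himg

/-- AN INDEPENDENT FAMILY IS AN INTERNAL DIRECT SUM OF ITS SUPREMUM: for `iSupIndep B` and `T = ⨆ B a`, the traces `(B a).comap T.subtype` form an internal direct sum of `↥T`.
[cite: Casselman1995, §6.3] -/
theorem isInternal_comap_subtype_of_iSupIndep {α : Type*} [DecidableEq α] (B : α → Submodule k M) (hB : iSupIndep B) (T : Submodule k M) (hT : T = ⨆ a, B a) :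
    DirectSum.IsInternal fun a => (B a).comap T.subtype := by
  subst hT
  rw [DirectSum.isInternal_submodule_iff_iSupIndep_and_iSup_eq_top]
  have hmap : ∀ a, ((B a).comap (⨆ a, B a).subtype).map (⨆ a, B a).subtype = B a := fun a => by
    rw [Submodule.map_comap_subtype, inf_eq_right.2 (le_iSup B a)]
  have hinj := Submodule.map_injective_of_injective (⨆ a, B a).injective_subtype
  constructor
  · intro a
    rw [disjoint_iff]
    apply hinj
    rw [Submodule.map_inf _ (⨆ a, B a).injective_subtype, Submodule.map_bot, hmap]
    simp_rw [Submodule.map_iSup, hmap]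
    exact disjoint_iff.1 (hB a)
  · apply hinj
    simp_rw [Submodule.map_iSup, hmap, Submodule.map_subtype_top]

/-- A finite-dimensional submodule read inside a bigger one stays finite-dimensional. [cite: Casselman1995, §6.3] -/
theorem finiteDimensional_comap_subtype_of_le {A T : Submodule k M} (hAT : A ≤ T) [FiniteDimensional k A] : FiniteDimensional k ↥(A.comap T.subtype) :=
  LinearEquiv.finiteDimensional (Submodule.comapSubtypeEquivOfLe hAT).symm

end Generic

/-! ## §2 Pointwise formulas on `0`- and `1`-chains -/

section Chains

variable {k Γ V : Type*} [Field k] [CharZero k] [Group Γ] [TopologicalSpace Γ] [IsTopologicalGroup Γ]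
  [AddCommGroup V] [Module k V] {ρ : Representation k Γ V}
variable {ι : Type*} [DecidableEq ι] {G : SimpleGraph ι} {a : Γ →* (G ≃g G)}
variable {τ : Representation k Γ (ι →₀ V)} (hτ : ∀ (g : Γ) (v : ι →₀ V), τ g v = Finsupp.mapRange (ρ g) (map_zero _) (Finsupp.equivMapDomain (a g).toEquiv v))
variable {τ₁ : Representation k Γ (G.edgeSet →₀ V)}
  (hτ₁ : ∀ (g : Γ) (c : G.edgeSet →₀ V), τ₁ g c = Finsupp.mapRange (ρ g) (map_zero _) (Finsupp.equivMapDomain (a g).mapEdgeSet c))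

omit [CharZero k] [TopologicalSpace Γ] [IsTopologicalGroup Γ] [DecidableEq ι] in
include hτ in
/-- `g · [x ↦ v] = [g·x ↦ ρ(g) v]` on `0`-chains. [cite: SchneiderStuhler1997, Ch. II §3 p. 123] -/
theorem rep_zeroChains_single (g : Γ) (x : ι) (v : V) : τ g (Finsupp.single x v) = Finsupp.single (a g x) (ρ g v) := by
  rw [hτ, Finsupp.equivMapDomain_single, Finsupp.mapRange_single]
  rfl

omit [CharZero k] [TopologicalSpace Γ] [IsTopologicalGroup Γ] [DecidableEq ι] in
include hτ₁ in
/-- `g · [e ↦ v] = [g·e ↦ ρ(g) v]` on `1`-chains. [cite: SchneiderStuhler1997, Ch. II §3 p. 123] -/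
theorem rep_oneChains_single (g : Γ) (e : G.edgeSet) (v : V) : τ₁ g (Finsupp.single e v) = Finsupp.single ((a g).mapEdgeSet e) (ρ g v) := by
  rw [hτ₁, Finsupp.equivMapDomain_single, Finsupp.mapRange_single]

omit [CharZero k] [TopologicalSpace Γ] [IsTopologicalGroup Γ] [DecidableEq ι] in
/-- `ρ(g) V^{U_x} ⊆ V^{U_{g·x}}` for transported vertex groups `U_{g·x} = g U_x g⁻¹` (★ row 23). [cite: SchneiderStuhler1997, Ch. III §4] -/
theorem apply_mem_fixedPoints_act {U : ι → Subgroup Γ} (hUa : ∀ (g : Γ) (x : ι), U (a g x) = (U x).map (MulAut.conj g).toMonoidHom) (g : Γ) {x : ι} {v : V}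
    (hv : v ∈ ρ.fixedPoints (U x)) : ρ g v ∈ ρ.fixedPoints (U (a g x)) := by
  rw [hUa]
  exact (ρ.mem_fixedPoints_map_conj_iff (U x) g v).2 hv

omit [CharZero k] [TopologicalSpace Γ] [IsTopologicalGroup Γ] [DecidableEq ι] in
/-- `ρ(g) V^{U_x ⊔ U_y} ⊆ V^{U_{g·x} ⊔ U_{g·y}}` (edge groups). [cite: SchneiderStuhler1997, Ch. III §4] -/
theorem apply_mem_fixedPoints_sup_act {U : ι → Subgroup Γ} (hUa : ∀ (g : Γ) (x : ι), U (a g x) = (U x).map (MulAut.conj g).toMonoidHom) (g : Γ) {x y : ι} {v : V}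
    (hv : v ∈ ρ.fixedPoints (U x ⊔ U y)) : ρ g v ∈ ρ.fixedPoints (U (a g x) ⊔ U (a g y)) := by
  rw [hUa, hUa, ← Subgroup.map_sup]
  exact (ρ.mem_fixedPoints_map_conj_iff (U x ⊔ U y) g v).2 hv

/-! ## §3 The global complex: three `Γ`-representations, smooth, with intertwining boundary and augmentation maps forming a short exact sequence -/

omit [CharZero k] [TopologicalSpace Γ] [IsTopologicalGroup Γ] [DecidableEq ι] in
include hτ hτ₁ in
/-- **`C₁(X)`, `C₀(X)`, `V|_X` ARE `Γ`-REPRESENTATIONS** (`S = univ`: every `g ∈ Γ` stabilises `X`; ★ 41d-II `rep_*_mem_*`). [cite: SchneiderStuhler1997, Ch. II §3 p. 123]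
[cite: MeyerSolleveld2010, §4 Prop. 4.1] -/
theorem exists_reps_univ (σ : Orientation G) (U : ι → Subgroup Γ) (hUa : ∀ (g : Γ) (x : ι), U (a g x) = (U x).map (MulAut.conj g).toMonoidHom)
    (hσa : ∀ (g : Γ) (e : G.edgeSet), σ.head ((a g).mapEdgeSet e) = a g (σ.head e) ∧ σ.tail ((a g).mapEdgeSet e) = a g (σ.tail e)) :
    ∃ (ρ₁ : Representation k Γ ↥(⨆ e ∈ {e : G.edgeSet | σ.head e ∈ (Set.univ : Set ι) ∧ σ.tail e ∈ (Set.univ : Set ι)},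
        (ρ.fixedPoints (U (σ.head e) ⊔ U (σ.tail e))).map (Finsupp.lsingle e : V →ₗ[k] G.edgeSet →₀ V)))
      (ρ₀ : Representation k Γ ↥(⨆ x ∈ (Set.univ : Set ι), (ρ.fixedPoints (U x)).map (Finsupp.lsingle x : V →ₗ[k] ι →₀ V)))
      (ρV : Representation k Γ ↥(⨆ x ∈ (Set.univ : Set ι), ρ.fixedPoints (U x))),
      (∀ (g : Γ) c, ((ρ₁ g c : _) : G.edgeSet →₀ V) = τ₁ g c) ∧ (∀ (g : Γ) v, ((ρ₀ g v : _) : ι →₀ V) = τ g v) ∧ (∀ (g : Γ) w, ((ρV g w : _) : V) = ρ g w) := by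
  obtain ⟨ρ₁, hρ₁⟩ := exists_rep_of_forall_apply_mem τ₁ _ fun g c hc => rep_oneChains_mem_oneChains hτ₁ σ U Set.univ hUa hσa (g := g) (fun _ => by simp) hc
  obtain ⟨ρ₀, hρ₀⟩ := exists_rep_of_forall_apply_mem τ _ fun g v hv => rep_zeroChains_mem_zeroChains hτ U Set.univ hUa (g := g) (fun _ => by simp) hv
  obtain ⟨ρV, hρV⟩ := exists_rep_of_forall_apply_mem ρ _ fun g w hw => rep_mem_restricted (a := a) U Set.univ hUa (g := g) (fun _ => by simp) hw
  exact ⟨ρ₁, ρ₀, ρV, hρ₁, hρ₀, hρV⟩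

omit [CharZero k] in
include hτ in
/-- **`C₀(X)` IS SMOOTH** as a `Γ`-representation (any `ρ₀` agreeing with `τ`), for open vertex stabilisers and open `U_x` (★ B1 at `P = ⊤` + §1). [cite: Casselman1995, §2.1]
[cite: SchneiderStuhler1997, Ch. III §4] -/
theorem isSmooth_rep_zeroChains_univ (hstab : ∀ x : ι, IsOpen {g : Γ | a g x = x}) (U : ι → Subgroup Γ) (hUo : ∀ x, IsOpen (U x : Set Γ)) (S : Set ι)
    {ρ₀ : Representation k Γ ↥(⨆ x ∈ S, (ρ.fixedPoints (U x)).map (Finsupp.lsingle x : V →ₗ[k] ι →₀ V))}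
    (hρ₀ : ∀ (g : Γ) v, ((ρ₀ g v : _) : ι →₀ V) = τ g v) : ρ₀.IsSmooth :=
  isSmooth_of_isSmooth_comp_subtype_top (isSmooth_rep_zeroChains hτ hstab U hUo S (P := ⊤) (ρ₀ := (ρ₀.comp (⊤ : Subgroup Γ).subtype : Representation k (⊤ : Subgroup Γ) _)) fun g v => hρ₀ g v)

omit [CharZero k] in
include hτ₁ in
/-- **`C₁(X)` IS SMOOTH** as a `Γ`-representation. [cite: Casselman1995, §2.1] [cite: SchneiderStuhler1997, Ch. III §4] -/
theorem isSmooth_rep_oneChains_univ (hstab : ∀ x : ι, IsOpen {g : Γ | a g x = x}) (σ : Orientation G) (U : ι → Subgroup Γ) (hUo : ∀ x, IsOpen (U x : Set Γ)) (S : Set ι)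
    {ρ₁ : Representation k Γ ↥(⨆ e ∈ {e : G.edgeSet | σ.head e ∈ S ∧ σ.tail e ∈ S},
      (ρ.fixedPoints (U (σ.head e) ⊔ U (σ.tail e))).map (Finsupp.lsingle e : V →ₗ[k] G.edgeSet →₀ V))}
    (hρ₁ : ∀ (g : Γ) c, ((ρ₁ g c : _) : G.edgeSet →₀ V) = τ₁ g c) : ρ₁.IsSmooth :=
  isSmooth_of_isSmooth_comp_subtype_top (isSmooth_rep_oneChains hτ₁ hstab σ U hUo S (P := ⊤) (ρ₁ := (ρ₁.comp (⊤ : Subgroup Γ).subtype : Representation k (⊤ : Subgroup Γ) _)) fun g c => hρ₁ g c)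

omit [CharZero k] [DecidableEq ι] in
/-- **`V|_X` IS SMOOTH** as a `Γ`-representation when `ρ` is. [cite: Casselman1995, §2.1] -/
theorem isSmooth_rep_restricted_univ (hρ : ρ.IsSmooth) (U : ι → Subgroup Γ) (S : Set ι) {ρV : Representation k Γ ↥(⨆ x ∈ S, ρ.fixedPoints (U x))}
    (hρV : ∀ (g : Γ) w, ((ρV g w : _) : V) = ρ g w) : ρV.IsSmooth :=
  isSmooth_of_isSmooth_comp_subtype_top (isSmooth_rep_restricted hρ U S (P := ⊤) (ρV := (ρV.comp (⊤ : Subgroup Γ).subtype : Representation k (⊤ : Subgroup Γ) _)) fun g w => hρV g w)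

omit [CharZero k] [TopologicalSpace Γ] [IsTopologicalGroup Γ] in
include hτ hτ₁ in
/-- **THE BOUNDARY MAP IS AN INTERTWINING MAP `C₁(S) → C₀(S)`** of `Γ`-representations (★ 41d-II `boundaryMap_rep`), with underlying linear map `D|`. [cite: SchneiderStuhler1997, Ch. II §3]
[cite: MeyerSolleveld2010, §4 Prop. 4.1] -/
theorem exists_intertwiningMap_boundary (σ : Orientation G) (U : ι → Subgroup Γ) (S : Set ι)
    (hσa : ∀ (g : Γ) (e : G.edgeSet), σ.head ((a g).mapEdgeSet e) = a g (σ.head e) ∧ σ.tail ((a g).mapEdgeSet e) = a g (σ.tail e))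
    {D : (G.edgeSet →₀ V) →ₗ[k] (ι →₀ V)} (hD : ∀ (c : G.edgeSet →₀ V) (u : ι), D c u = c.sum fun e m => σ.incMatrix k u e • m)
    (hDC : ∀ c ∈ ⨆ e ∈ {e : G.edgeSet | σ.head e ∈ S ∧ σ.tail e ∈ S}, (ρ.fixedPoints (U (σ.head e) ⊔ U (σ.tail e))).map (Finsupp.lsingle e : V →ₗ[k] G.edgeSet →₀ V),
      D c ∈ ⨆ x ∈ S, (ρ.fixedPoints (U x)).map (Finsupp.lsingle x : V →ₗ[k] ι →₀ V))
    {ρ₁ : Representation k Γ ↥(⨆ e ∈ {e : G.edgeSet | σ.head e ∈ S ∧ σ.tail e ∈ S}, (ρ.fixedPoints (U (σ.head e) ⊔ U (σ.tail e))).map (Finsupp.lsingle e : V →ₗ[k] G.edgeSet →₀ V))}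
    (hρ₁ : ∀ (g : Γ) c, ((ρ₁ g c : _) : G.edgeSet →₀ V) = τ₁ g c)
    {ρ₀ : Representation k Γ ↥(⨆ x ∈ S, (ρ.fixedPoints (U x)).map (Finsupp.lsingle x : V →ₗ[k] ι →₀ V))} (hρ₀ : ∀ (g : Γ) v, ((ρ₀ g v : _) : ι →₀ V) = τ g v) :
    ∃ f : ρ₁.IntertwiningMap ρ₀, f.toLinearMap = D.restrict hDC := by
  refine ⟨⟨D.restrict hDC, fun g => LinearMap.ext fun c => Subtype.ext ?_⟩, rfl⟩
  simp only [LinearMap.coe_comp, Function.comp_apply, LinearMap.restrict_apply]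
  show D ((ρ₁ g c : _) : G.edgeSet →₀ V) = ((ρ₀ g (⟨D c, hDC c c.2⟩) : _) : ι →₀ V)
  rw [hρ₁, hρ₀, boundaryMap_rep hτ hτ₁ σ hσa hD]

omit [CharZero k] [TopologicalSpace Γ] [IsTopologicalGroup Γ] [DecidableEq ι] in
include hτ in
/-- **THE AUGMENTATION IS AN INTERTWINING MAP `C₀(S) → V|_S`** (★ 41d-II `augmentationMap_rep`), with underlying linear map `E|`. [cite: MeyerSolleveld2010, Thm. 2.4] -/
theorem exists_intertwiningMap_augmentation (U : ι → Subgroup Γ) (S : Set ι) {E : (ι →₀ V) →ₗ[k] V} (hE : ∀ v : ι →₀ V, E v = v.sum fun _ m => m)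
    (hEC : ∀ v ∈ ⨆ x ∈ S, (ρ.fixedPoints (U x)).map (Finsupp.lsingle x : V →ₗ[k] ι →₀ V), E v ∈ ⨆ x ∈ S, ρ.fixedPoints (U x))
    {ρ₀ : Representation k Γ ↥(⨆ x ∈ S, (ρ.fixedPoints (U x)).map (Finsupp.lsingle x : V →ₗ[k] ι →₀ V))} (hρ₀ : ∀ (g : Γ) v, ((ρ₀ g v : _) : ι →₀ V) = τ g v)
    {ρV : Representation k Γ ↥(⨆ x ∈ S, ρ.fixedPoints (U x))} (hρV : ∀ (g : Γ) w, ((ρV g w : _) : V) = ρ g w) :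
    ∃ q : ρ₀.IntertwiningMap ρV, q.toLinearMap = E.restrict hEC := by
  refine ⟨⟨E.restrict hEC, fun g => LinearMap.ext fun v => Subtype.ext ?_⟩, rfl⟩
  simp only [LinearMap.coe_comp, Function.comp_apply, LinearMap.restrict_apply]
  show E ((ρ₀ g v : _) : ι →₀ V) = ((ρV g (⟨E v, hEC v v.2⟩) : _) : V)
  rw [hρ₀, hρV, augmentationMap_rep hτ hE]

/-- **`0 → C₁(X) → C₀(X) → V|_X → 0` IS A SHORT EXACT SEQUENCE OF `Γ`-REPRESENTATIONS** (★ 41d FILE I `shortExact_restrict` at `S = univ`, which is root-closed toward any vertex):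
for `G` a tree, compact vertex groups with (U6)–(U7), `ρ` smooth, and intertwining maps `f`, `q` with underlying maps `D|`, `E|`. [cite: SchneiderStuhler1997, Thm. II.3.1]
[cite: MeyerSolleveld2010, Thm. 2.4] -/
theorem shortExact_univ (hT : G.IsTree) (σ : Orientation G) (U : ι → Subgroup Γ) (hU : ∀ z, IsCompact (U z : Set Γ))
    (hU6 : ∀ x y, G.Adj x y → ((U x ⊔ U y : Subgroup Γ) : Set Γ) = (U x : Set Γ) * (U y : Set Γ))
    (hU7 : ∀ x y z, G.Adj x y → G.dist y z + 1 = G.dist x z → ((U y : Subgroup Γ) : Set Γ) ⊆ (U x : Set Γ) * (U z : Set Γ)) (hρ : ρ.IsSmooth)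
    {D : (G.edgeSet →₀ V) →ₗ[k] (ι →₀ V)} (hD : ∀ (c : G.edgeSet →₀ V) (u : ι), D c u = c.sum fun e m => σ.incMatrix k u e • m)
    {E : (ι →₀ V) →ₗ[k] V} (hE : ∀ v : ι →₀ V, E v = v.sum fun _ m => m)
    (hDC : ∀ c ∈ ⨆ e ∈ {e : G.edgeSet | σ.head e ∈ (Set.univ : Set ι) ∧ σ.tail e ∈ (Set.univ : Set ι)},
        (ρ.fixedPoints (U (σ.head e) ⊔ U (σ.tail e))).map (Finsupp.lsingle e : V →ₗ[k] G.edgeSet →₀ V),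
      D c ∈ ⨆ x ∈ (Set.univ : Set ι), (ρ.fixedPoints (U x)).map (Finsupp.lsingle x : V →ₗ[k] ι →₀ V))
    (hEC : ∀ v ∈ ⨆ x ∈ (Set.univ : Set ι), (ρ.fixedPoints (U x)).map (Finsupp.lsingle x : V →ₗ[k] ι →₀ V), E v ∈ ⨆ x ∈ (Set.univ : Set ι), ρ.fixedPoints (U x))
    {ρ₁ : Representation k Γ ↥(⨆ e ∈ {e : G.edgeSet | σ.head e ∈ (Set.univ : Set ι) ∧ σ.tail e ∈ (Set.univ : Set ι)},
      (ρ.fixedPoints (U (σ.head e) ⊔ U (σ.tail e))).map (Finsupp.lsingle e : V →ₗ[k] G.edgeSet →₀ V))}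
    {ρ₀ : Representation k Γ ↥(⨆ x ∈ (Set.univ : Set ι), (ρ.fixedPoints (U x)).map (Finsupp.lsingle x : V →ₗ[k] ι →₀ V))}
    {ρV : Representation k Γ ↥(⨆ x ∈ (Set.univ : Set ι), ρ.fixedPoints (U x))}
    (f : ρ₁.IntertwiningMap ρ₀) (hf : f.toLinearMap = D.restrict hDC) (q : ρ₀.IntertwiningMap ρV) (hq : q.toLinearMap = E.restrict hEC) :
    Function.Injective f ∧ Function.Exact f q ∧ Function.Surjective q := by
  obtain ⟨r⟩ := hT.1.nonempty
  obtain ⟨hinj, hrange, hsurj⟩ := shortExact_restrict σ U Set.univ hD hE hT hU hU6 hU7 hρ (r := r) (fun _ _ y _ _ => Set.mem_univ y) hDC hEC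
  have hf' : (f : _ → _) = D.restrict hDC := by rw [← hf]; rfl
  have hq' : (q : _ → _) = E.restrict hEC := by rw [← hq]; rfl
  refine ⟨by rw [hf']; exact hinj, ?_, by rw [hq']; exact hsurj⟩
  rw [hf', hq']
  exact LinearMap.exact_iff.2 hrange.symm

/-! ## §4 The blocks: internal direct sums permuted by `Γ` -/

omit [CharZero k] [TopologicalSpace Γ] [IsTopologicalGroup Γ] in
/-- **THE VERTEX BLOCKS `[x ↦ V^{U_x}]` FORM AN INTERNAL DIRECT SUM OF `C₀(X)`** (★ FILE I `iSupIndep_zeroBlocks` + §1). [cite: SchneiderStuhler1997, Ch. II §3] [cite: Casselman1995, §6.3] -/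
theorem isInternal_zeroBlocks_univ (U : ι → Subgroup Γ) :
    DirectSum.IsInternal fun x : ι => ((ρ.fixedPoints (U x)).map (Finsupp.lsingle x : V →ₗ[k] ι →₀ V)).comap
      (⨆ x ∈ (Set.univ : Set ι), (ρ.fixedPoints (U x)).map (Finsupp.lsingle x : V →ₗ[k] ι →₀ V)).subtype :=
  isInternal_comap_subtype_of_iSupIndep _ (iSupIndep_zeroBlocks U) _ (by simp only [Set.mem_univ, iSup_pos])

omit [CharZero k] [TopologicalSpace Γ] [IsTopologicalGroup Γ] in
/-- **THE EDGE BLOCKS `[e ↦ V^{U_e}]` FORM AN INTERNAL DIRECT SUM OF `C₁(X)`** (★ FILE I `iSupIndep_oneBlocks` + §1). [cite: SchneiderStuhler1997, Ch. II §3] [cite: Casselman1995, §6.3] -/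
theorem isInternal_oneBlocks_univ (σ : Orientation G) (U : ι → Subgroup Γ) :
    DirectSum.IsInternal fun e : G.edgeSet => ((ρ.fixedPoints (U (σ.head e) ⊔ U (σ.tail e))).map (Finsupp.lsingle e : V →ₗ[k] G.edgeSet →₀ V)).comap
      (⨆ e ∈ {e : G.edgeSet | σ.head e ∈ (Set.univ : Set ι) ∧ σ.tail e ∈ (Set.univ : Set ι)},
        (ρ.fixedPoints (U (σ.head e) ⊔ U (σ.tail e))).map (Finsupp.lsingle e : V →ₗ[k] G.edgeSet →₀ V)).subtype :=
  isInternal_comap_subtype_of_iSupIndep _ (iSupIndep_oneBlocks σ U) _ (by simp only [Set.mem_univ, true_and, Set.setOf_true, iSup_pos])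

omit [CharZero k] [TopologicalSpace Γ] [IsTopologicalGroup Γ] [DecidableEq ι] in
include hτ in
/-- **`Γ` PERMUTES THE VERTEX BLOCKS ALONG ITS ACTION ON VERTICES**: `g · [x ↦ V^{U_x}] ⊆ [g·x ↦ V^{U_{g·x}}]` inside `C₀(S)` (the letter `hperm` of ★ 47c). [cite: Casselman1995, §6.3]
[cite: SchneiderStuhler1997, Ch. III §4] -/
theorem rep_mem_zeroBlock (U : ι → Subgroup Γ) (S : Set ι) (hUa : ∀ (g : Γ) (x : ι), U (a g x) = (U x).map (MulAut.conj g).toMonoidHom)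
    {ρ₀ : Representation k Γ ↥(⨆ x ∈ S, (ρ.fixedPoints (U x)).map (Finsupp.lsingle x : V →ₗ[k] ι →₀ V))} (hρ₀ : ∀ (g : Γ) v, ((ρ₀ g v : _) : ι →₀ V) = τ g v)
    (g : Γ) (x : ι) (m : ↥(⨆ x ∈ S, (ρ.fixedPoints (U x)).map (Finsupp.lsingle x : V →ₗ[k] ι →₀ V)))
    (hm : m ∈ ((ρ.fixedPoints (U x)).map (Finsupp.lsingle x : V →ₗ[k] ι →₀ V)).comap (⨆ x ∈ S, (ρ.fixedPoints (U x)).map (Finsupp.lsingle x : V →ₗ[k] ι →₀ V)).subtype) :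
    ρ₀ g m ∈ ((ρ.fixedPoints (U (a g x))).map (Finsupp.lsingle (a g x) : V →ₗ[k] ι →₀ V)).comap (⨆ x ∈ S, (ρ.fixedPoints (U x)).map (Finsupp.lsingle x : V →ₗ[k] ι →₀ V)).subtype := by
  rw [Submodule.mem_comap, Submodule.subtype_apply] at hm ⊢
  obtain ⟨v, hv, hvm⟩ := Submodule.mem_map.1 hm
  refine Submodule.mem_map.2 ⟨ρ g v, apply_mem_fixedPoints_act hUa g hv, ?_⟩
  rw [hρ₀, ← hvm, Finsupp.lsingle_apply, Finsupp.lsingle_apply, rep_zeroChains_single hτ]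

omit [CharZero k] [TopologicalSpace Γ] [IsTopologicalGroup Γ] [DecidableEq ι] in
include hτ₁ in
/-- **`Γ` PERMUTES THE EDGE BLOCKS ALONG ITS ACTION ON EDGES** (invariant orientation: `head (g·e) = g·head e`, `tail (g·e) = g·tail e`). [cite: Casselman1995, §6.3]
[cite: SchneiderStuhler1997, Ch. III §4] -/
theorem rep_mem_oneBlock (σ : Orientation G) (U : ι → Subgroup Γ) (S : Set ι) (hUa : ∀ (g : Γ) (x : ι), U (a g x) = (U x).map (MulAut.conj g).toMonoidHom)
    (hσa : ∀ (g : Γ) (e : G.edgeSet), σ.head ((a g).mapEdgeSet e) = a g (σ.head e) ∧ σ.tail ((a g).mapEdgeSet e) = a g (σ.tail e))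
    {ρ₁ : Representation k Γ ↥(⨆ e ∈ {e : G.edgeSet | σ.head e ∈ S ∧ σ.tail e ∈ S}, (ρ.fixedPoints (U (σ.head e) ⊔ U (σ.tail e))).map (Finsupp.lsingle e : V →ₗ[k] G.edgeSet →₀ V))}
    (hρ₁ : ∀ (g : Γ) c, ((ρ₁ g c : _) : G.edgeSet →₀ V) = τ₁ g c) (g : Γ) (e : G.edgeSet)
    (m : ↥(⨆ e ∈ {e : G.edgeSet | σ.head e ∈ S ∧ σ.tail e ∈ S}, (ρ.fixedPoints (U (σ.head e) ⊔ U (σ.tail e))).map (Finsupp.lsingle e : V →ₗ[k] G.edgeSet →₀ V)))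
    (hm : m ∈ ((ρ.fixedPoints (U (σ.head e) ⊔ U (σ.tail e))).map (Finsupp.lsingle e : V →ₗ[k] G.edgeSet →₀ V)).comap
      (⨆ e ∈ {e : G.edgeSet | σ.head e ∈ S ∧ σ.tail e ∈ S}, (ρ.fixedPoints (U (σ.head e) ⊔ U (σ.tail e))).map (Finsupp.lsingle e : V →ₗ[k] G.edgeSet →₀ V)).subtype) :
    ρ₁ g m ∈ ((ρ.fixedPoints (U (σ.head ((a g).mapEdgeSet e)) ⊔ U (σ.tail ((a g).mapEdgeSet e)))).map
        (Finsupp.lsingle ((a g).mapEdgeSet e) : V →ₗ[k] G.edgeSet →₀ V)).comap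
      (⨆ e ∈ {e : G.edgeSet | σ.head e ∈ S ∧ σ.tail e ∈ S}, (ρ.fixedPoints (U (σ.head e) ⊔ U (σ.tail e))).map (Finsupp.lsingle e : V →ₗ[k] G.edgeSet →₀ V)).subtype := by
  rw [Submodule.mem_comap, Submodule.subtype_apply] at hm ⊢
  obtain ⟨v, hv, hvm⟩ := Submodule.mem_map.1 hm
  refine Submodule.mem_map.2 ⟨ρ g v, ?_, ?_⟩
  · rw [(hσa g e).1, (hσa g e).2]
    exact apply_mem_fixedPoints_sup_act hUa g hv
  · rw [hρ₁, ← hvm, Finsupp.lsingle_apply, Finsupp.lsingle_apply, rep_oneChains_single hτ₁]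

omit [CharZero k] [TopologicalSpace Γ] [IsTopologicalGroup Γ] [DecidableEq ι] in
/-- The vertex block of `x` inside `C₀(S)` is finite-dimensional when `V^{U_x}` is (`x ∈ S`). [cite: Casselman1995, §6.3] -/
theorem finiteDimensional_zeroBlock (U : ι → Subgroup Γ) (S : Set ι) {x : ι} (hx : x ∈ S) [FiniteDimensional k (ρ.fixedPoints (U x))] :
    FiniteDimensional k ↥(((ρ.fixedPoints (U x)).map (Finsupp.lsingle x : V →ₗ[k] ι →₀ V)).comap
      (⨆ x ∈ S, (ρ.fixedPoints (U x)).map (Finsupp.lsingle x : V →ₗ[k] ι →₀ V)).subtype) :=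
  finiteDimensional_comap_subtype_of_le
    (le_biSup (fun x => (ρ.fixedPoints (U x)).map (Finsupp.lsingle x : V →ₗ[k] ι →₀ V)) hx)

omit [CharZero k] [TopologicalSpace Γ] [IsTopologicalGroup Γ] [DecidableEq ι] in
/-- The edge block of `e` inside `C₁(S)` is finite-dimensional when `V^{U_e}` is (`e` an edge of `S`). [cite: Casselman1995, §6.3] -/
theorem finiteDimensional_oneBlock (σ : Orientation G) (U : ι → Subgroup Γ) (S : Set ι) {e : G.edgeSet} (he : σ.head e ∈ S ∧ σ.tail e ∈ S)
    [FiniteDimensional k (ρ.fixedPoints (U (σ.head e) ⊔ U (σ.tail e)))] :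
    FiniteDimensional k ↥(((ρ.fixedPoints (U (σ.head e) ⊔ U (σ.tail e))).map (Finsupp.lsingle e : V →ₗ[k] G.edgeSet →₀ V)).comap
      (⨆ e ∈ {e : G.edgeSet | σ.head e ∈ S ∧ σ.tail e ∈ S}, (ρ.fixedPoints (U (σ.head e) ⊔ U (σ.tail e))).map (Finsupp.lsingle e : V →ₗ[k] G.edgeSet →₀ V)).subtype) :=
  finiteDimensional_comap_subtype_of_le
    (le_biSup (fun e : G.edgeSet => (ρ.fixedPoints (U (σ.head e) ⊔ U (σ.tail e))).map (Finsupp.lsingle e : V →ₗ[k] G.edgeSet →₀ V)) he)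

end Chains

end Representation
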